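import Literature.NumberTheory.EllipticCurves.OrdinaryReductionTateModuleProofs
import Literature.NumberTheory.Automorphic.BCDTModularity
import Literature.NumberTheory.Automorphic.SerreConjectureProofs
import Literature.NumberTheory.GaloisRepresentations.SerreWeightShapeProofs
import HarnessLib

/-!
# The `p`-torsion at a place of good ordinary reduction above `p`: Serre's line `X_p`
# (Serre 1972, §1.11, Prop. 11 and Cor.) and the inertia shape `(χ *; 0 1)` of `ρ̄_{E,p}|I_p`

`Proofs` file (theorems only: no definition, no named fact, no `sorry`), topic
`NumberTheory/EllipticCurves`; the level-`p` companion of `OrdinaryReductionTateModuleProofs`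
(Part II, Greenberg's ordinary filtration of `V_pE`), whose architecture and local setup are
followed verbatim.

J.-P. Serre, *Propriétés galoisiennes des points d'ordre fini des courbes elliptiques*, Invent.
Math. 15 (1972), §1.11 ("bonne réduction de hauteur 1"), Prop. 11 and Corollaire: for an elliptic
curve with good ordinary reduction at a place `v` of residue characteristic `p`, the kernel `X_p`
of the reduction map `E_p → Ẽ_p` is a line, stable under the decomposition group; the inertia
group acts on `X_p` through `χ^e · (unit)` — through the cyclotomic character `χ` when `e = 1` —
and trivially on `E_p / X_p = Ẽ_p`: *"l'image de `I` dans `Aut(E_p)` est contenue dans un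
sous-groupe de Borel … de la forme `(χ *; 0 1)`"* (Cor.; Serre 1987, §2.8 (2.8.2) and Prop. 3).

* `exists_goodReduction_localModel` — the local setup shared with the sequels (peu ramifié,
  supersingular shape): for `E` over a number field `K` with good reduction at `v`, the spectral
  valuation `w` of `K̄_v`, the `𝒪_w`-model `MO` of the local minimal model (unit discriminant),
  the identity `X_{K̄_v} = MO_{K̄_v}` and the `Γ_{K_v}`-equivariant transport
  `Φ₀ : E(K̄_v) ≃ X(K̄_v)` (Steps 0–1 and 4 of Part II of `OrdinaryReductionTateModuleProofs`).
* `goodReduction_reduction_line` — for `v ∣ p` of good ORDINARY reduction, the reduction map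
  `f : E(K̄) → MO~(k_w)` built from that setup is `Γ_{K_v}`-stable on its kernel, invariant under
  inertia, and `#(ker f ∩ E[p]) = p` (Steps 2–3, 5–7).
* `exists_line_geomTorsion_of_not_dvd_frobeniusTraceAt` — for `E` over a number field `K`, a
  prime `p` and a place `v ∣ p` of good ORDINARY reduction (`p ∤ a_v`): there is a subgroup
  `Λ ≤ E[p] = E(K̄)[p]` of order `p`, stable under the decomposition group
  `Γ_{K_v} → Γ_K` (tree `absGaloisRestrict`), such that the inertia group `I_{K_v}` (tree
  `absInertia`) acts trivially on `E[p]/Λ` (`res τ • x - x ∈ Λ`).  `Λ` is the kernel of the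
  reduction map on `E[p]` (Greenberg's `F¹` at level `p`); the proof is Part II of
  `OrdinaryReductionTateModuleProofs` with the Tate-module step replaced by a count at level `p`
  (`natCard_torsionBy_ker_goodReductionHom_eq`, `OrdinaryReductionKernelTorsionProofs` §5).
* `exists_conj_eq_of_line` — consequently any framed `ρ̄` with `W.IsTorsionGaloisRep p ρ̄` becomes,
  after a change of basis `Q ∈ GL₂(𝔽_p)`, upper triangular on `I_{K_v}` with diagonal
  `(χ̄_p(res τ), 1)` — the top entry is the determinant, which is the cyclotomic character
  (`det_eq_modPCyclotomicCharacter_of_isTorsionGaloisRep_holds`, the Weil pairing).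
(The level-one inertia shape `(ψ₁ *; 0 1)` over `ℚ` is deduced in the sequel
`OrdinaryReductionInertiaShapeProofs`, and *peu ramifié* in `OrdinaryReductionPeuRamifieProofs`.)

Tools: `modPCyclotomicCharacterZMod_absGaloisRestrict` (`χ̄_p(res τ) = χ̄_p(τ)`),
`conj_eq_of_mulVec_eq` (a `2 × 2` matrix with `M w₁ = a w₁`, `M w₂ = c w₁ + d w₂` is
`!![a, c; 0, d]` in the basis `(w₁, w₂)`).

## References

* [SerreInventiones1972] J.-P. Serre, Invent. Math. 15 (1972) 259–331, §1.11, Prop. 11, Cor.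
* [Serre1987] J.-P. Serre, Duke Math. J. 54 (1987), §2.8, (2.8.2) and Prop. 3; §4.1 (4.1.11).
* [Greenberg1991] R. Greenberg, *Iwasawa theory for motives*, LMS LNS 153 (1991), §2, p. 214.
* [SilvermanAEC2009] J. H. Silverman, *The Arithmetic of Elliptic Curves*, 2nd ed. (2009),
  III.6.4, III.8, V.3.1, VII.2.1–2.2, VII.3.1.
* [SilvermanCSS1997] Cornell–Silverman–Stevens, Ch. II §7 (`det ρ̄_m = χ_m`).
-/

noncomputable section

open scoped Classical NNReal NumberField AddSubgroup
open NumberField IsDedekindDomain Polynomial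

universe u v w

/-! ## §A The mod `p` cyclotomic character is compatible with restriction -/

namespace Literature.NumberTheory.GaloisRepresentations

open Field

/-- **`χ̄_p(res σ) = χ̄_p(σ)`**: for an extension `L/K` and `σ ∈ Γ_L`, the mod `p` cyclotomic
character of `K` at `res σ = absGaloisRestrict K L σ` is that of `L` at `σ` (both are pinned down
by the action on the `p`-th roots of unity `ζ ∈ K̄` and `ι ζ ∈ L̄`, `ι (res σ • ζ) = σ • ι ζ`).
The `p`-adic version is `cyclotomicCharacter_absGaloisRestrict` (`LocalKroneckerWeberInertiaProofs`).
Ref: Serre, *Abelian ℓ-adic representations* (1968), Ch. I §1.2. [folklore] -/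
theorem modPCyclotomicCharacterZMod_absGaloisRestrict (K L : Type*) [Field K] [Field L]
    [Algebra K L] (p : ℕ) [Fact p.Prime] [NeZero (p : K)] [NeZero (p : L)]
    (σ : absoluteGaloisGroup L) :
    modPCyclotomicCharacterZMod K p (absGaloisRestrict K L σ) = modPCyclotomicCharacterZMod L p σ := by
  haveI : NeZero ((p : ℕ) : AlgebraicClosure K) :=
    NeZero.nat_of_injective (algebraMap K (AlgebraicClosure K)).injective
  obtain ⟨ζ, hζ⟩ := HasEnoughRootsOfUnity.exists_primitiveRoot (AlgebraicClosure K) p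
  have hζ' : IsPrimitiveRoot (absClosureEmbedding K L ζ) p :=
    hζ.map_of_injective (absClosureEmbedding K L).injective
  have h1 := modPCyclotomicCharacterZMod_spec K p (absGaloisRestrict K L σ) ζ hζ.pow_eq_one
  have h2 := modPCyclotomicCharacterZMod_spec L p σ (absClosureEmbedding K L ζ) hζ'.pow_eq_one
  have h3 := congrArg (absClosureEmbedding K L) h1
  rw [absGaloisRestrict_apply_smul, map_pow, h2] at h3
  have h4 := hζ'.pow_inj (ZMod.val_lt _) (ZMod.val_lt _) h3.symm
  exact Units.ext (ZMod.val_injective _ h4)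

end Literature.NumberTheory.GaloisRepresentations

/-! ## §B A `2 × 2` matrix in a basis made of an eigenvector and a second vector -/

namespace Literature.NumberTheory.EllipticCurves

/-- If `Q` has columns `w₁, w₂` (`Q e₀ = w₁`, `Q e₁ = w₂`) and `M w₁ = a w₁`,
`M w₂ = c w₁ + d w₂`, then `Q⁻¹ M Q = !![a, c; 0, d]`. [folklore] -/
theorem conj_eq_of_mulVec_eq {k : Type*} [Field k] {Q : GL (Fin 2) k} {M : Matrix (Fin 2) (Fin 2) k}
    {w₁ w₂ : Fin 2 → k} {a c d : k}
    (hQ₀ : (Q : Matrix (Fin 2) (Fin 2) k).mulVec (Pi.single 0 1) = w₁)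
    (hQ₁ : (Q : Matrix (Fin 2) (Fin 2) k).mulVec (Pi.single 1 1) = w₂)
    (h₁ : M.mulVec w₁ = a • w₁) (h₂ : M.mulVec w₂ = c • w₁ + d • w₂) :
    ((Q⁻¹ : GL (Fin 2) k) : Matrix (Fin 2) (Fin 2) k) * M * (Q : Matrix (Fin 2) (Fin 2) k) =
      !![a, c; 0, d] := by
  set N := ((Q⁻¹ : GL (Fin 2) k) : Matrix (Fin 2) (Fin 2) k) * M * (Q : Matrix (Fin 2) (Fin 2) k)
    with hN
  have hinv : ∀ w : Fin 2 → k, ((Q⁻¹ : GL (Fin 2) k) : Matrix (Fin 2) (Fin 2) k).mulVec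
      ((Q : Matrix (Fin 2) (Fin 2) k).mulVec w) = w := by
    intro w
    rw [Matrix.mulVec_mulVec, ← Matrix.GeneralLinearGroup.coe_mul, inv_mul_cancel,
      Matrix.GeneralLinearGroup.coe_one, Matrix.one_mulVec]
  have hc0 : N.mulVec (Pi.single 0 1) = a • Pi.single 0 1 := by
    rw [hN, ← Matrix.mulVec_mulVec, ← Matrix.mulVec_mulVec, hQ₀, h₁, Matrix.mulVec_smul, ← hQ₀, hinv]
  have hc1 : N.mulVec (Pi.single 1 1) = c • Pi.single 0 1 + d • Pi.single 1 1 := by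
    rw [hN, ← Matrix.mulVec_mulVec, ← Matrix.mulVec_mulVec, hQ₁, h₂, Matrix.mulVec_add,
      Matrix.mulVec_smul, Matrix.mulVec_smul, ← hQ₀, ← hQ₁, hinv, hinv]
  ext i j
  fin_cases j
  · have := congrFun hc0 i
    rw [Matrix.mulVec_single_one] at this
    fin_cases i <;> simp_all
  · have := congrFun hc1 i
    rw [Matrix.mulVec_single_one] at this
    fin_cases i <;> simp_all

end Literature.NumberTheory.EllipticCurves

/-! ## §C Serre's line `X_p ≤ E[p]` at a place of good ordinary reduction above `p` -/

namespace Literature.NumberTheory.EllipticCurves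

open _root_.WeierstrassCurve Literature.NumberTheory.GaloisRepresentations Field
  IsDedekindDomain.HeightOneSpectrum

/-- **The local good-reduction setup** (Part II of `OrdinaryReductionTateModuleProofs`, Steps 0, 1,
4, stated once for the sequels).  For an elliptic curve `E` over a number field `K` with good
reduction at `v`: the spectral valuation `w = |·|_v` of `K̄_v` (`exists_spectralValuation`), the
ring map `φ : 𝓞_v → 𝒪_w` (so that the `𝒪_w`-model `MO = M.map φ` of the local minimal model
`M = W.localMinimalIntegralModel v` has unit discriminant), the identity of curves
`X_{K̄_v} = MO_{K̄_v}` for `X = M_{K_v}`, and the transport `Φ₀ : E(K̄_v) ≃ X(K̄_v)` (variable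
change `C` with `C • E_{K_v} = X`), which is `Γ_{K_v}`-equivariant
(`VariableChange.pointEquivBaseChange_map_algEquiv`, `congrEquiv_smul`).
[cite: SilvermanAEC2009, Prop. VII.2.1, VII.1 (minimal models)] -/
theorem exists_goodReduction_localModel {K : Type} [Field K] [NumberField K]
    (W : WeierstrassCurve K) [W.IsElliptic] (v : HeightOneSpectrum (𝓞 K))
    (hgood : W.HasGoodReductionAt v) :
    ∃ (w : Valuation (AlgebraicClosure (v.adicCompletion K)) ℝ≥0)
      (_ : ∀ x, (w x : ℝ) =
        spectralNorm (v.adicCompletion K) (AlgebraicClosure (v.adicCompletion K)) x)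
      (φ : v.adicCompletionIntegers K →+* w.valuationSubring)
      (Φ₀ : localPoints W (v.adicCompletion K) ≃+
        (((W.localMinimalIntegralModel v).map
          (algebraMap (v.adicCompletionIntegers K) (v.adicCompletion K))).baseChange
            (AlgebraicClosure (v.adicCompletion K))).toAffine.Point),
      ((W.localMinimalIntegralModel v).map
          (algebraMap (v.adicCompletionIntegers K) (v.adicCompletion K))).baseChange
            (AlgebraicClosure (v.adicCompletion K)) =
          ((W.localMinimalIntegralModel v).map φ).baseChange (AlgebraicClosure (v.adicCompletion K)) ∧
      (∀ c, ((φ c : w.valuationSubring) : AlgebraicClosure (v.adicCompletion K)) =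
          algebraMap (v.adicCompletion K) (AlgebraicClosure (v.adicCompletion K)) c) ∧
      IsUnit ((W.localMinimalIntegralModel v).map φ).Δ ∧
      (∀ (σ : absoluteGaloisGroup (v.adicCompletion K)) (Q : localPoints W (v.adicCompletion K)),
        Φ₀ (σ • Q) = Affine.Point.map
          ((absoluteGaloisGroup.toAlgEquiv (v.adicCompletion K) σ :
              AlgebraicClosure (v.adicCompletion K) ≃ₐ[v.adicCompletion K]
                AlgebraicClosure (v.adicCompletion K)) :
            AlgebraicClosure (v.adicCompletion K) →ₐ[v.adicCompletion K]
              AlgebraicClosure (v.adicCompletion K)) (Φ₀ Q)) := by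
  obtain ⟨w, hw⟩ := v.exists_spectralValuation
  let O : ValuationSubring (AlgebraicClosure (v.adicCompletion K)) := w.valuationSubring
  /- Step 0: the local minimal model `M / 𝓞_v` (unit discriminant), `C • E_{K_v} = M_{K_v}`. -/
  let M : WeierstrassCurve (v.adicCompletionIntegers K) := W.localMinimalIntegralModel v
  let C : VariableChange (v.adicCompletion K) :=
    ((W.baseChange (v.adicCompletion K)).exists_isMinimal (v.adicCompletionIntegers K)).choose
  have hCM : C • W.baseChange (v.adicCompletion K) =
      M.map (algebraMap (v.adicCompletionIntegers K) (v.adicCompletion K)) :=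
    (baseChange_integralModel_eq (v.adicCompletionIntegers K) (W.localMinimalModel v)).symm
  have hΔ : IsUnit M.Δ := by
    have hell := (hasGoodReduction_iff_isElliptic_reduction (R := v.adicCompletionIntegers K)
      (W := W.localMinimalModel v)).mp hgood
    have hu := hell.isUnit
    rw [reduction, map_Δ] at hu
    exact (_root_.isUnit_map_iff (IsLocalRing.residue _) _).mp hu
  /- Step 1: the model `MO` over `𝒪_w`, `X = M_{K_v}`. -/
  let φ : v.adicCompletionIntegers K →+* O :=
    ((algebraMap (v.adicCompletion K) (AlgebraicClosure (v.adicCompletion K))).comp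
      (algebraMap (v.adicCompletionIntegers K) (v.adicCompletion K))).codRestrict O fun a ↦
      (Valuation.mem_valuationSubring_iff w _).mpr
        ((spectralValuation_algebraMap_le_one_iff hw _).mpr a.2)
  have hΔO : IsUnit (M.map φ).Δ := by rw [map_Δ]; exact hΔ.map φ
  have hφ : ∀ c, ((φ c : O) : AlgebraicClosure (v.adicCompletion K)) =
      algebraMap (v.adicCompletion K) (AlgebraicClosure (v.adicCompletion K)) c := fun c ↦ rfl
  let X : WeierstrassCurve (v.adicCompletion K) :=
    M.map (algebraMap (v.adicCompletionIntegers K) (v.adicCompletion K))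
  have hX : X.baseChange (AlgebraicClosure (v.adicCompletion K)) =
      (M.map φ).baseChange (AlgebraicClosure (v.adicCompletion K)) := by
    change (M.map _).baseChange _ = _
    rw [baseChange, baseChange, WeierstrassCurve.map_map, WeierstrassCurve.map_map]
    rfl
  /- Step 4: the transport `Φ₀ : E(K̄_v) ≃ X(K̄_v)` and its equivariance. -/
  have hCM' := congrArg (fun Y : WeierstrassCurve (v.adicCompletion K) ↦
    Y.baseChange (AlgebraicClosure (v.adicCompletion K))) hCM
  let Φ₀ : localPoints W (v.adicCompletion K) ≃+
      (X.baseChange (AlgebraicClosure (v.adicCompletion K))).toAffine.Point :=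
    ((Affine.Point.congrEquiv (baseChange_baseChange_adicCompletion W v).symm).trans
      (VariableChange.pointEquivBaseChange (W.baseChange (v.adicCompletion K)) C
        (AlgebraicClosure (v.adicCompletion K)))).trans
      (Affine.Point.congrEquiv hCM')
  have hΦ₀ : ∀ (σ : absoluteGaloisGroup (v.adicCompletion K))
      (Q : localPoints W (v.adicCompletion K)),
      Φ₀ (σ • Q) = Affine.Point.map
        ((absoluteGaloisGroup.toAlgEquiv (v.adicCompletion K) σ :
            AlgebraicClosure (v.adicCompletion K) ≃ₐ[v.adicCompletion K]
              AlgebraicClosure (v.adicCompletion K)) :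
          AlgebraicClosure (v.adicCompletion K) →ₐ[v.adicCompletion K]
            AlgebraicClosure (v.adicCompletion K)) (Φ₀ Q) := by
    intro σ Q
    change Affine.Point.congrEquiv hCM' (VariableChange.pointEquivBaseChange
        (W.baseChange (v.adicCompletion K)) C (AlgebraicClosure (v.adicCompletion K))
        (Affine.Point.congrEquiv (baseChange_baseChange_adicCompletion W v).symm (σ • Q))) =
      Affine.Point.map _ (Affine.Point.congrEquiv hCM'
        (VariableChange.pointEquivBaseChange (W.baseChange (v.adicCompletion K)) C
          (AlgebraicClosure (v.adicCompletion K))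
          (Affine.Point.congrEquiv (baseChange_baseChange_adicCompletion W v).symm Q)))
    rw [congrEquiv_smul, VariableChange.pointEquivBaseChange_map_algEquiv]
    exact Affine.Point.congrEquiv_baseChange_map hCM _ _
  exact ⟨w, hw, φ, Φ₀, hX, hφ, hΔO, hΦ₀⟩

/-- **The reduction map on `E(K̄)` at a place of good ORDINARY reduction above `p`** (Part II of
`OrdinaryReductionTateModuleProofs`, Steps 2–3 and 5–7, at level `p`).  In the setup of
`exists_goodReduction_localModel`, let `f = red ∘ Φ ∘ pointsMap : E(K̄) → MO~(k_w)` be the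
reduction map (`red = goodReductionHom`, Silverman VII.2.1; `Φ = congrEquiv hX ∘ Φ₀`).  If
`v ∣ p` and `p ∤ a_v` then: `ker f` is stable under `Γ_{K_v}` (isometries preserve `E₁`,
`reducesToZero_congrEquiv_map_iff`); `f` is invariant under the inertia group
(`reducePoint_congrEquiv_map_eq`); and `#(ker f ∩ E[p]) = p` (the ordinary count
`natCard_torsionBy_ker_goodReductionHom_eq`, transported along `pointsMap`, `#E[p] = p²` on both
sides).  Serre (1972), §1.11, Prop. 11 (the line `X_p`); Greenberg (1991), §2.
[cite: SerreInventiones1972, §1.11 Prop. 11 and Cor.] [cite: Greenberg1991, §2 (p. 214)]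
[cite: SilvermanAEC2009, Prop. VII.2.1, VII.3.1, Cor. III.6.4] -/
theorem goodReduction_reduction_line {K : Type} [Field K] [NumberField K]
    (W : WeierstrassCurve K) [W.IsElliptic] (p : ℕ) [hp : Fact p.Prime]
    (v : HeightOneSpectrum (𝓞 K)) (hpv : (p : 𝓞 K) ∈ v.asIdeal) (hgood : W.HasGoodReductionAt v)
    (hord : ¬ ((p : ℤ) ∣ W.frobeniusTraceAt v))
    {w : Valuation (AlgebraicClosure (v.adicCompletion K)) ℝ≥0}
    (hw : ∀ x, (w x : ℝ) =
      spectralNorm (v.adicCompletion K) (AlgebraicClosure (v.adicCompletion K)) x)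
    {φ : v.adicCompletionIntegers K →+* w.valuationSubring}
    (hΔO : IsUnit ((W.localMinimalIntegralModel v).map φ).Δ)
    (hX : ((W.localMinimalIntegralModel v).map
        (algebraMap (v.adicCompletionIntegers K) (v.adicCompletion K))).baseChange
          (AlgebraicClosure (v.adicCompletion K)) =
        ((W.localMinimalIntegralModel v).map φ).baseChange (AlgebraicClosure (v.adicCompletion K)))
    (Φ₀ : localPoints W (v.adicCompletion K) ≃+
      (((W.localMinimalIntegralModel v).map
        (algebraMap (v.adicCompletionIntegers K) (v.adicCompletion K))).baseChange
          (AlgebraicClosure (v.adicCompletion K))).toAffine.Point)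
    (hΦ₀ : ∀ (σ : absoluteGaloisGroup (v.adicCompletion K)) (Q : localPoints W (v.adicCompletion K)),
      Φ₀ (σ • Q) = Affine.Point.map
        ((absoluteGaloisGroup.toAlgEquiv (v.adicCompletion K) σ :
            AlgebraicClosure (v.adicCompletion K) ≃ₐ[v.adicCompletion K]
              AlgebraicClosure (v.adicCompletion K)) :
          AlgebraicClosure (v.adicCompletion K) →ₐ[v.adicCompletion K]
            AlgebraicClosure (v.adicCompletion K)) (Φ₀ Q))
    (f : geomPoints W →+
      (((W.localMinimalIntegralModel v).map φ).map (IsLocalRing.residue w.valuationSubring)).toAffine.Point)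
    (hf : ∀ a, f a = goodReductionHom ((W.localMinimalIntegralModel v).map φ)
      (Valuation.valuationSubring.integers w) hΔO
      (Affine.Point.congrEquiv hX (Φ₀ (pointsMap W (v.adicCompletion K) a)))) :
    (∀ (σ : absoluteGaloisGroup (v.adicCompletion K)) (a : geomPoints W),
        f a = 0 → f (absGaloisRestrict K (v.adicCompletion K) σ • a) = 0) ∧
      (∀ σ ∈ absInertia (v.adicCompletion K), ∀ a : geomPoints W,
        f (absGaloisRestrict K (v.adicCompletion K) σ • a) = f a) ∧
      Nat.card ↥(f.ker ⊓ geomTorsion W p) = p := by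
  haveI : CharZero (v.adicCompletion K) :=
    charZero_of_injective_algebraMap (algebraMap K (v.adicCompletion K)).injective
  haveI : CharZero (AlgebraicClosure (v.adicCompletion K)) :=
    charZero_of_injective_algebraMap
      (algebraMap (v.adicCompletion K) (AlgebraicClosure (v.adicCompletion K))).injective
  have hvO : w.Integers w.valuationSubring := Valuation.valuationSubring.integers w
  haveI hMOell : ((W.localMinimalIntegralModel v).map φ).IsElliptic := ⟨hΔO⟩
  have hEv : W.reductionAt v = (W.localMinimalIntegralModel v).map
      (IsLocalRing.residue (v.adicCompletionIntegers K)) := rfl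
  set red := goodReductionHom ((W.localMinimalIntegralModel v).map φ) hvO hΔO with hreddef
  let σE : absoluteGaloisGroup (v.adicCompletion K) →
      (AlgebraicClosure (v.adicCompletion K) →ₐ[v.adicCompletion K]
        AlgebraicClosure (v.adicCompletion K)) := fun σ ↦
    ((absoluteGaloisGroup.toAlgEquiv (v.adicCompletion K) σ :
        AlgebraicClosure (v.adicCompletion K) ≃ₐ[v.adicCompletion K]
          AlgebraicClosure (v.adicCompletion K)) :
      AlgebraicClosure (v.adicCompletion K) →ₐ[v.adicCompletion K]
        AlgebraicClosure (v.adicCompletion K))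
  /- residue characteristic `p` on both sides -/
  have hpO : w ((p : ℕ) : AlgebraicClosure (v.adicCompletion K)) < 1 := by
    have h := spectralValuation_algebraMap_ringOfIntegers_lt_one (v := v) hw hpv
    rwa [map_natCast] at h
  haveI hchar : CharP (IsLocalRing.ResidueField w.valuationSubring) p := by
    refine (CharP.charP_iff_prime_eq_zero hp.out).mpr ?_
    rw [← map_natCast (IsLocalRing.residue w.valuationSubring), IsLocalRing.residue_eq_zero_iff,
      IsLocalRing.mem_maximalIdeal, mem_nonunits_iff, hvO.isUnit_iff_valuation_eq_one]
    exact fun h ↦ absurd h (ne_of_lt (by simpa using hpO))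
  haveI hcharv : CharP (IsLocalRing.ResidueField (v.adicCompletionIntegers K)) p := by
    refine (CharP.charP_iff_prime_eq_zero hp.out).mpr ?_
    have h := (residue_algebraMap_eq_zero_iff K v (p : 𝓞 K)).mpr hpv
    rwa [map_natCast, map_natCast] at h
  /- Step 2 ("good, ordinary"): some `p`-torsion point of `MO(K̄_v)` has non-zero reduction. -/
  haveI := isElliptic_reductionAt hgood
  have hdegE : ((W.reductionAt v).ΨSq p).natDegree ≠ 0 :=
    natDegree_ΨSq_ne_zero_of_not_dvd_trace (W.reductionAt v) p
      (by rwa [frobeniusTraceAt_def] at hord)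
  have hdegMO : ((((W.localMinimalIntegralModel v).map φ).ΨSq p).map
      (IsLocalRing.residue w.valuationSubring)).natDegree ≠ 0 := by
    rw [WeierstrassCurve.map_ΨSq]
    refine natDegree_map_map_residue_ne_zero φ _ ?_
    rwa [hEv, WeierstrassCurve.map_ΨSq] at hdegE
  have hordMO := exists_zsmul_eq_zero_goodReductionHom_ne_zero w.valuationSubring hvO hΔO p hdegMO
  /- Step 3: the ordinary count `#(ker red ∩ E[p]) = p`. -/
  have h5 := natCard_torsionBy_ker_goodReductionHom_eq w.valuationSubring hvO hΔO hordMO 1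
  /- Step 5: `Γ_{K_v}` acts by isometries, inertia moves integers within `𝓂_w`. -/
  have hσ₁ : ∀ (σ : absoluteGaloisGroup (v.adicCompletion K))
      (z : AlgebraicClosure (v.adicCompletion K)), w (σE σ z) = w z :=
    fun σ z ↦ spectralValuation_smul hw σ z
  have hσ₂ : ∀ σ ∈ absInertia (v.adicCompletion K),
      ∀ z : AlgebraicClosure (v.adicCompletion K), w z ≤ 1 → w (σE σ z - z) < 1 := by
    intro σ hσ z hz
    rw [mem_absInertia_iff_algNorm] at hσ
    exact (spectralValuation_lt_one_iff_algNorm_lt_one hw _).mpr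
      (hσ z ((spectralValuation_le_one_iff_algNorm_le_one hw z).mp hz))
  have hfσ : ∀ (σ : absoluteGaloisGroup (v.adicCompletion K)) (a : geomPoints W),
      f (absGaloisRestrict K (v.adicCompletion K) σ • a) =
        red (Affine.Point.congrEquiv hX (Affine.Point.map (σE σ)
          (Φ₀ (pointsMap W (v.adicCompletion K) a)))) := by
    intro σ a
    rw [hf, ← resGal_eq_absGaloisRestrict, pointsMap_smul, hΦ₀]
  have hstab : ∀ (σ : absoluteGaloisGroup (v.adicCompletion K)) (a : geomPoints W),
      f a = 0 → f (absGaloisRestrict K (v.adicCompletion K) σ • a) = 0 := by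
    intro σ a ha
    rw [hf, hreddef, goodReductionHom_eq_zero_iff] at ha
    rw [hfσ, hreddef, goodReductionHom_eq_zero_iff]
    exact (reducesToZero_congrEquiv_map_iff _ hX (σE σ) (hσ₁ σ) _).mpr ha
  have hinv : ∀ σ ∈ absInertia (v.adicCompletion K), ∀ a : geomPoints W,
      f (absGaloisRestrict K (v.adicCompletion K) σ • a) = f a := by
    intro σ hσ a
    rw [hfσ, hf, hreddef, goodReductionHom_apply, goodReductionHom_apply]
    exact reducePoint_congrEquiv_map_eq _ hX (σE σ) (hσ₁ σ) (hσ₂ σ hσ) _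
  refine ⟨hstab, hinv, ?_⟩
  /- Step 6: counting `#E[p] = p²` on both sides; all `p`-torsion of `E(K̄_v)` is algebraic. -/
  let Φ : localPoints W (v.adicCompletion K) ≃+
      (((W.localMinimalIntegralModel v).map φ).baseChange
        (AlgebraicClosure (v.adicCompletion K))).toAffine.Point :=
    Φ₀.trans (Affine.Point.congrEquiv hX)
  have hf' : ∀ a : geomPoints W, f a = red (Φ (pointsMap W (v.adicCompletion K) a)) :=
    fun a ↦ hf a
  have hp0 : p ≠ 0 := hp.out.ne_zero
  have hA : Nat.card (geomTorsion W p) = p ^ 2 :=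
    card_torsionBy_eq_sq (E := W.baseChange (AlgebraicClosure K)) (n := p) (by exact_mod_cast hp0)
  have hcardL : Nat.card ((localPoints W (v.adicCompletion K))[(p : ℕ)]) = p ^ 2 :=
    card_torsionBy_eq_sq (E := W.baseChange (AlgebraicClosure (v.adicCompletion K))) (n := p)
      (by exact_mod_cast hp0)
  haveI : Finite ((localPoints W (v.adicCompletion K))[(p : ℕ)]) :=
    Nat.finite_of_card_ne_zero (by rw [hcardL]; positivity)
  have hsurjL : ∀ Q ∈ (localPoints W (v.adicCompletion K))[(p : ℕ)],
      ∃ x ∈ geomTorsion W p, pointsMap W (v.adicCompletion K) x = Q := fun Q hQ ↦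
    exists_mem_torsionBy_eq_of_injective (pointsMap W (v.adicCompletion K))
      (pointsMapOfEmb_injective W (closureEmb (K := K) (v.adicCompletion K))) p
      (le_of_eq (by rw [hcardL, hA])) Q hQ
  /- Step 7: `#(ker f ∩ E[p]) = p`: `x ↦ Φ (pointsMap x)` is a bijection onto `ker red ∩ MO[p]`. -/
  have hker : Nat.card ((red.ker)[((p : ℤ) ^ 1)]) = p ^ 1 := h5.1
  rw [pow_one, pow_one] at hker
  let g : ↥(f.ker ⊓ geomTorsion W p) → ↥((red.ker)[(p : ℤ)]) := fun x ↦
    ⟨⟨Φ (pointsMap W (v.adicCompletion K) x), by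
      have hx := (AddSubgroup.mem_inf.mp x.2).1
      rwa [AddMonoidHom.mem_ker, hf'] at hx⟩, by
      have hx := (AddSubgroup.mem_inf.mp x.2).2
      rw [mem_torsionBy_iff] at hx ⊢
      refine Subtype.ext ?_
      change (p : ℤ) • Φ (pointsMap W (v.adicCompletion K) x) = 0
      rw [← map_zsmul, ← map_zsmul, hx, map_zero, map_zero]⟩
  have hg_inj : Function.Injective g := by
    intro x y hxy
    have h1 : Φ (pointsMap W (v.adicCompletion K) x) = Φ (pointsMap W (v.adicCompletion K) y) :=
      congrArg (fun z : ↥((red.ker)[(p : ℤ)]) ↦ (z.1.1)) hxy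
    exact Subtype.ext (pointsMapOfEmb_injective W (closureEmb (K := K) (v.adicCompletion K))
      (Φ.injective h1))
  have hg_surj : Function.Surjective g := by
    rintro ⟨⟨P, hP⟩, hPp⟩
    rw [mem_torsionBy_iff] at hPp
    have hPp' : (p : ℤ) • P = 0 := congrArg Subtype.val hPp
    set Q := Φ.symm P with hQdef
    have hQ : Q ∈ (localPoints W (v.adicCompletion K))[(p : ℕ)] := by
      rw [mem_torsionBy_iff, hQdef, ← map_zsmul, hPp', map_zero]
    obtain ⟨x, hx, hxQ⟩ := hsurjL Q hQ
    refine ⟨⟨x, AddSubgroup.mem_inf.mpr ⟨?_, hx⟩⟩, ?_⟩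
    · rw [AddMonoidHom.mem_ker, hf', hxQ, hQdef, AddEquiv.apply_symm_apply]
      exact hP
    · refine Subtype.ext (Subtype.ext ?_)
      change Φ (pointsMap W (v.adicCompletion K) x) = P
      rw [hxQ, hQdef, AddEquiv.apply_symm_apply]
  exact (Nat.card_eq_of_bijective g ⟨hg_inj, hg_surj⟩).trans hker

/-- **Serre 1972, §1.11, Prop. 11 and Cor. at level `p` (the line `X_p`).**  Let `E` be an elliptic
curve over a number field `K`, `p` a prime and `v ∣ p` a finite place of good ORDINARY reduction
(`p ∤ a_v`, `WeierstrassCurve.frobeniusTraceAt`).  Then there is a subgroup `Λ ≤ E[p] = E(K̄)[p]`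
of order `p` which is stable under the decomposition group `Γ_{K_v}` (realised as
`absGaloisRestrict K K_v : Γ_{K_v} → Γ_K`) and such that the inertia group `I_{K_v} = absInertia K_v`
acts trivially on `E[p] / Λ`.  `Λ` is the kernel of the reduction map
`E[p] → Ẽ_v(k̄_v)[p]` at the good local model (Serre's `X_p`, Greenberg's `F¹` at level `p`):
`exists_goodReduction_localModel` and `goodReduction_reduction_line`.
[cite: SerreInventiones1972, §1.11 Prop. 11 and Cor.] [cite: Greenberg1991, §2 (p. 214)]
[cite: SilvermanAEC2009, Prop. VII.2.1, VII.3.1, Cor. III.6.4] -/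
theorem exists_line_geomTorsion_of_not_dvd_frobeniusTraceAt {K : Type} [Field K] [NumberField K]
    (W : WeierstrassCurve K) [W.IsElliptic] (p : ℕ) [hp : Fact p.Prime]
    (v : HeightOneSpectrum (𝓞 K)) (hpv : (p : 𝓞 K) ∈ v.asIdeal) (hgood : W.HasGoodReductionAt v)
    (hord : ¬ ((p : ℤ) ∣ W.frobeniusTraceAt v)) :
    ∃ Λ : AddSubgroup (geomPoints W), Λ ≤ geomTorsion W p ∧ Nat.card Λ = p ∧
      (∀ (τ : absoluteGaloisGroup (v.adicCompletion K)), ∀ x ∈ Λ,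
        absGaloisRestrict K (v.adicCompletion K) τ • x ∈ Λ) ∧
      (∀ τ ∈ absInertia (v.adicCompletion K), ∀ x ∈ geomTorsion W p,
        absGaloisRestrict K (v.adicCompletion K) τ • x - x ∈ Λ) := by
  obtain ⟨w, hw, φ, Φ₀, hX, _, hΔO, hΦ₀⟩ := exists_goodReduction_localModel W v hgood
  set f : geomPoints W →+ (((W.localMinimalIntegralModel v).map φ).map
      (IsLocalRing.residue w.valuationSubring)).toAffine.Point :=
    (goodReductionHom ((W.localMinimalIntegralModel v).map φ)
      (Valuation.valuationSubring.integers w) hΔO).comp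
      (((Φ₀.trans (Affine.Point.congrEquiv hX)).toAddMonoidHom).comp
        (pointsMap W (v.adicCompletion K))) with hfdef
  obtain ⟨hstab, hinv, hcard⟩ := goodReduction_reduction_line W p v hpv hgood hord hw hΔO hX Φ₀ hΦ₀
    f (fun a ↦ rfl)
  refine ⟨f.ker ⊓ geomTorsion W p, inf_le_right, hcard, ?_, ?_⟩
  · /- stability under the decomposition group -/
    intro τ x hx
    obtain ⟨hx1, hx2⟩ := AddSubgroup.mem_inf.mp hx
    refine AddSubgroup.mem_inf.mpr ⟨?_, ?_⟩
    · rw [AddMonoidHom.mem_ker] at hx1 ⊢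
      exact hstab τ x hx1
    · rw [mem_torsionBy_iff] at hx2 ⊢
      rw [smul_comm (p : ℤ), hx2, smul_zero]
  · /- inertia acts trivially on `E[p] / Λ` -/
    intro τ hτ x hx
    refine AddSubgroup.mem_inf.mpr ⟨?_, ?_⟩
    · rw [AddMonoidHom.mem_ker, map_sub, hinv τ hτ, sub_self]
    · rw [mem_torsionBy_iff] at hx ⊢
      rw [smul_sub, smul_comm (p : ℤ), hx, smul_zero, sub_self]

end Literature.NumberTheory.EllipticCurves

/-! ## §D A framing of `E[p]` is upper triangular on inertia, with diagonal `(det, 1)` -/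

namespace WeierstrassCurve

open Literature.NumberTheory.GaloisRepresentations Literature.NumberTheory.EllipticCurves Field
  Literature.NumberTheory.GaloisRepresentations.ModPGaloisRep.InertiaShape

/-- **Triangular form of `ρ̄_{E,p}` on inertia from Serre's line.**  Let `Λ ≤ E[p]` be a subgroup of
order `p`, stable under the elements `res τ`, `τ ∈ I_{K_v}`, and such that `res τ • x - x ∈ Λ` for
all `x ∈ E[p]`.  Then for every framed `ρ̄` with `W.IsTorsionGaloisRep p ρ̄` there is a change of
basis `Q ∈ GL₂(𝔽_p)` (columns: a generator `x₁` of `Λ` and any `x₂ ∈ E[p] ∖ Λ`) with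
`Q⁻¹ ρ̄(res τ) Q = !![det ρ̄(res τ), c; 0, 1]` for all `τ ∈ I_{K_v}` (`res τ • x₁ = a x₁`,
`res τ • x₂ = c x₁ + x₂`, and `a = a · 1 = det`).  Serre: "l'image de `I` … est contenue dans un
sous-groupe de Borel".
[cite: SerreInventiones1972, §1.11 Cor. of Prop. 11] -/
theorem IsTorsionGaloisRep.exists_conj_eq_of_line {K : Type} [Field K] [NumberField K]
    {W : WeierstrassCurve K} [W.IsElliptic] {p : ℕ} [hp : Fact p.Prime]
    {ρ : ModPGaloisRep K (ZMod p) 2} (hρ : W.IsTorsionGaloisRep p ρ)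
    {v : HeightOneSpectrum (𝓞 K)} {Λ : AddSubgroup (geomPoints W)} (hΛ : Λ ≤ geomTorsion W p)
    (hcard : Nat.card Λ = p)
    (hstab : ∀ τ ∈ absInertia (v.adicCompletion K), ∀ x ∈ Λ,
      absGaloisRestrict K (v.adicCompletion K) τ • x ∈ Λ)
    (hquot : ∀ τ ∈ absInertia (v.adicCompletion K), ∀ x ∈ geomTorsion W p,
      absGaloisRestrict K (v.adicCompletion K) τ • x - x ∈ Λ) :
    ∃ Q : GL (Fin 2) (ZMod p), ∀ τ ∈ absInertia (v.adicCompletion K), ∃ c : ZMod p,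
      ((Q⁻¹ * ρ (absGaloisRestrict K (v.adicCompletion K) τ) * Q : GL (Fin 2) (ZMod p)) :
          Matrix (Fin 2) (Fin 2) (ZMod p)) =
        !![((Matrix.GeneralLinearGroup.det (ρ (absGaloisRestrict K (v.adicCompletion K) τ)) :
            (ZMod p)ˣ) : ZMod p), c; 0, 1] := by
  obtain ⟨e, he⟩ := hρ
  have hp0 : p ≠ 0 := hp.out.ne_zero
  -- `#E[p] = p²`
  have hA : Nat.card (geomTorsion W p) = p ^ 2 :=
    card_torsionBy_eq_sq (E := W.baseChange (AlgebraicClosure K)) (n := p) (by exact_mod_cast hp0)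
  haveI : Finite (geomTorsion W p) := Nat.finite_of_card_ne_zero (by rw [hA]; positivity)
  haveI : Finite Λ := Nat.finite_of_card_ne_zero (by rw [hcard]; exact hp0)
  -- a generator `x₁ ≠ 0` of `Λ`
  have hnt : 1 < Nat.card Λ := by rw [hcard]; exact hp.out.one_lt
  haveI : Nontrivial Λ := Finite.one_lt_card_iff_nontrivial.mp hnt
  obtain ⟨⟨x₁, hx₁Λ⟩, hx₁0⟩ := exists_ne (0 : Λ)
  have hx₁ne : x₁ ≠ 0 := fun h ↦ hx₁0 (Subtype.ext h)
  have hx₁p : (p : ℤ) • x₁ = 0 := mem_torsionBy_iff.mp (hΛ hx₁Λ)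
  have hord₁ : addOrderOf x₁ = p := by
    refine addOrderOf_eq_prime ?_ hx₁ne
    rw [← natCast_zsmul]; exact hx₁p
  have hzm : AddSubgroup.zmultiples x₁ = Λ := by
    refine AddSubgroup.eq_of_le_of_card_ge ?_ ?_
    · exact (AddSubgroup.zmultiples_le_of_mem hx₁Λ)
    · rw [hcard, Nat.card_zmultiples, hord₁]
  have hmemΛ : ∀ x ∈ Λ, ∃ n : ℤ, n • x₁ = x := by
    intro x hx
    rw [← hzm, AddSubgroup.mem_zmultiples_iff] at hx
    exact hx
  -- a second vector `x₂ ∈ E[p] ∖ Λ`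
  obtain ⟨x₂, hx₂, hx₂Λ⟩ : ∃ x₂ ∈ geomTorsion W p, x₂ ∉ Λ := by
    by_contra hno
    push Not at hno
    have hle : Nat.card (geomTorsion W p) ≤ Nat.card Λ :=
      Nat.card_le_card_of_injective (fun x : geomTorsion W p ↦ (⟨x.1, hno x.1 x.2⟩ : Λ))
        (fun x y hxy ↦ Subtype.ext (by simpa using congrArg Subtype.val hxy))
    rw [hA, hcard] at hle
    have := hp.out.one_lt
    nlinarith
  -- the frame vectors
  set X₁ : geomTorsion W p := ⟨x₁, hΛ hx₁Λ⟩ with hX₁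
  set X₂ : geomTorsion W p := ⟨x₂, hx₂⟩ with hX₂
  set w₁ : Fin 2 → ZMod p := e X₁ with hw₁
  set w₂ : Fin 2 → ZMod p := e X₂ with hw₂
  have hw₁0 : w₁ ≠ 0 := by
    intro h0
    apply hx₁ne
    have : X₁ = 0 := e.injective (by rw [← hw₁, h0, map_zero])
    exact congrArg Subtype.val this
  have hdet : w₁ 0 * w₂ 1 - w₂ 0 * w₁ 1 ≠ 0 := by
    intro h0
    obtain ⟨c, hc⟩ := exists_eq_smul_of_det_eq_zero hw₁0 h0
    apply hx₂Λ
    have hX : X₂ = c.val • X₁ := by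
      apply e.injective
      rw [map_nsmul, ← hw₁, ← hw₂, hc, ← Nat.cast_smul_eq_nsmul (ZMod p), ZMod.natCast_zmod_val]
    have : x₂ = c.val • x₁ := congrArg Subtype.val hX
    rw [this]
    exact AddSubgroup.nsmul_mem _ hx₁Λ _
  obtain ⟨Q, hQ₀, hQ₁⟩ := exists_gl_mulVec_single_eq w₁ w₂ hdet
  refine ⟨Q, fun τ hτ ↦ ?_⟩
  set g := absGaloisRestrict K (v.adicCompletion K) τ with hg
  set M : Matrix (Fin 2) (Fin 2) (ZMod p) :=
    ((ρ g : GL (Fin 2) (ZMod p)) : Matrix (Fin 2) (Fin 2) (ZMod p)) with hM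
  -- `g • x₁ = a x₁`
  obtain ⟨a, ha⟩ := hmemΛ _ (hstab τ hτ x₁ hx₁Λ)
  have h₁ : M.mulVec w₁ = (a : ZMod p) • w₁ := by
    have hgX : g • X₁ = a • X₁ := Subtype.ext (by
      rw [Literature.NumberTheory.EllipticCurves.AddSubgroup.torsionBy.coe_smul]; exact ha.symm)
    rw [hw₁, ← he g X₁, hgX, map_zsmul, Int.cast_smul_eq_zsmul]
  -- `g • x₂ = c x₁ + x₂`
  obtain ⟨c, hc⟩ := hmemΛ _ (hquot τ hτ x₂ hx₂)
  have h₂ : M.mulVec w₂ = (c : ZMod p) • w₁ + (1 : ZMod p) • w₂ := by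
    have hgX : g • X₂ = c • X₁ + X₂ := Subtype.ext (by
      rw [Literature.NumberTheory.EllipticCurves.AddSubgroup.torsionBy.coe_smul]
      change g • x₂ = c • x₁ + x₂
      rw [hc, sub_add_cancel])
    rw [hw₂, hw₁, ← he g X₂, hgX, map_add, map_zsmul, Int.cast_smul_eq_zsmul, one_smul]
  have hconj := conj_eq_of_mulVec_eq hQ₀ hQ₁ h₁ h₂
  refine ⟨c, ?_⟩
  rw [Matrix.GeneralLinearGroup.coe_mul, Matrix.GeneralLinearGroup.coe_mul, ← hM, hconj]
  -- the top-left entry is the determinant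
  have hdetM : Matrix.det M = (a : ZMod p) := by
    have h := congrArg Matrix.det hconj
    rw [Matrix.det_units_conj', Matrix.det_fin_two_of] at h
    rw [h]; ring
  rw [Matrix.GeneralLinearGroup.val_det_apply, ← hM, hdetM]

end WeierstrassCurve
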